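import Summits.BirchSwinnertonDyer.BirchSwinnertonDyer.Theorems.EisensteinPrimesX1AnalyticLambdaCertificate
import Summits.BirchSwinnertonDyer.BirchSwinnertonDyer.Theorems.EisensteinPrimesX2AnalyticLambdaCertificate
import Literature.NumberTheory.LFunctions.DworkRationalityDworkLemma
import HarnessLib

/-!
# Route `EisensteinPrimes`, line `mudescent`, stub `stub_lambdaCountWeak_offLocus` (crux 3
# `MazurMCOnCellB`, stmt-BirchSwinnertonDyer-19033): the SECONDARY Birch reading — an UNDETERMINED
# twisted value pins a low coefficient of the `p`-adic `L`-function exactly (helper; closes nothing)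

Seat `bsd-eis-lam-a` g14 (PROGRAMME PART 1b, ACCEL-LIST (4): ANALYTIC side of the λ-count stub);
kernel face of the by-product of JOB «engM-deep8» (HOME/bsd-eis/lam-a-g14/, kit j304238: on the
five deep cells @3 the Birch sum at level 5 read `V = 55 = φ(3⁴) + 1` while level 6 gave `λ ≥ 81`).
HONEST FRAMING. THEOREMS ONLY — pure `Λ = ℤ_p⟦T⟧` algebra plus the tree's twisted-interpolation
plumbing; no definition, no new named fact; nothing about any particular curve is asserted; closes
nothing; moves no label. Companion of `Iwasawa/LambdaInvariantValuationTwisted.lean`, whose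
`mu_eq_zero_and_lam_eq_of_norm_twist_pow_eq` reads ONE Birch sum of valuation `< 1` as `(μ, λ)` and
whose `norm_twist_le_iff` says a value `≤ 1/p` only means `μ ≥ 1 ∨ λ ≥ φ`. HERE that undetermined
regime is READ: for `G ∈ Λ` with `μ(G) = 0`, `λ(G) = n`, `0 < |z| < 1`, `k < n`, `p⁻¹ < |z|^k`,
`|z|ⁿ < p⁻¹|z|^k` (for `z = ζ − 1`, `ζ` of order `p^{m+1}`: the reading `V = φ(p^{m+1}) + k` with
`k < φ(p^{m+1})`, `φ(p^{m+1}) + k < n`) and `|G(z)| = p⁻¹|z|^k`, the coefficient `[T^k]G` has absolute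
value EXACTLY `1/p` and all earlier ones `≤ p⁻²` (`norm_coeff_eq_of_norm_tsum_eq_secondary`:
ultrametric isolation of the term `k`; no Weierstrass preparation). Hence `[T^k]G ≠ 0`,
`ord_{T=0} G ≤ k`, and with `k = 1`, `L(0) = 0`: **`ord_{T=0}(ϖ·L_p) = 1` from TWO twisted values**
(`order_eq_one_of_two_twists`) — the input `hordL` of `Typed/PAdicCertificateEngine` and, through
Kato–Wuthrich's divisibility, the analytic face of Schneider's non-degeneracy rider at a rank-one
pair, supplied by modular symbols (engine M) instead of a `p`-adic height. §1 isolation lemma; §2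
root-of-unity form; §3 twisted-interpolation form for any `(f, α)` and the good-ordinary case.
References: [Washington1997] §7.1–7.2; [MazurTateTeitelbaum1986Invent] §I.13–I.14; [Schneider1985].
-/

set_option linter.dupNamespace false
set_option autoImplicit false

noncomputable section

open scoped Classical MatrixGroups ModularForm

open PowerSeries CongruenceSubgroup WeierstrassCurve
  Literature.NumberTheory.EllipticCurves
  Literature.NumberTheory.EllipticCurves.ModularForms
  Literature.NumberTheory.EllipticCurves.GreenbergVatsal2000
  Summit.BirchSwinnertonDyer.Rank1Residual
  Summit.BirchSwinnertonDyer.Rank1Residual.X1.MuLambda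
  Summit.BirchSwinnertonDyer.Rank1Residual.X11a
  Summit.BirchSwinnertonDyer.Rank1Residual.X11a.LambdaNorm
  Summit.BirchSwinnertonDyer.Rank1Residual.Iwasawa

namespace Summit.BirchSwinnertonDyer.BirchSwinnertonDyer.Theorems.EisensteinPrimesSecondaryBirchReading

variable {p : ℕ} [hp : Fact p.Prime]

/-! ## §0. Discreteness of the norm on `ℤ_p`; small ultrametric facts -/

/-- `‖x‖ < 1/p ⇒ ‖x‖ ≤ p⁻²` in `ℤ_p`. [folklore] -/
theorem norm_le_inv_sq_of_norm_lt_inv {x : ℤ_[p]} (h : ‖x‖ < (p : ℝ)⁻¹) :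
    ‖x‖ ≤ (p : ℝ)⁻¹ ^ 2 := by
  have h' : ‖x‖ < (p : ℝ) ^ ((-2 : ℤ) + 1) := by
    have : ((-2 : ℤ) + 1) = -1 := by norm_num
    rw [this, zpow_neg_one]; exact h
  have := (PadicInt.norm_le_pow_iff_norm_lt_pow_add_one x (-2)).mpr h'
  have e : (p : ℝ) ^ (-2 : ℤ) = (p : ℝ)⁻¹ ^ 2 := by
    rw [inv_pow, ← zpow_natCast, ← zpow_neg]; norm_num
  rw [← e]; exact this

/-- Trichotomy step: `‖x‖ ≤ 1/p` and `¬ ‖x‖ ≤ p⁻²` force `‖x‖ = 1/p`. [folklore] -/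
theorem norm_eq_inv_of_le_of_not_le {x : ℤ_[p]} (h1 : ‖x‖ ≤ (p : ℝ)⁻¹)
    (h2 : ¬ ‖x‖ ≤ (p : ℝ)⁻¹ ^ 2) : ‖x‖ = (p : ℝ)⁻¹ := by
  by_contra hne
  exact h2 (norm_le_inv_sq_of_norm_lt_inv (lt_of_le_of_ne h1 hne))

/-- Ultrametric domination: `‖b‖ < ‖a‖ ⇒ ‖a + b‖ = ‖a‖` in `ℂ_p`. [folklore] -/
theorem norm_add_eq_left_of_lt {a b : ℂ_[p]} (h : ‖b‖ < ‖a‖) : ‖a + b‖ = ‖a‖ := by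
  rw [IsUltrametricDist.norm_add_eq_max_of_norm_ne_norm (ne_of_gt h), max_eq_left h.le]

/-! ## §1. The isolation lemma: an undetermined value pins the coefficient `[T^k]G` -/

section Isolation
/-- Norm of the `j`-th term of the evaluation series: `‖ιℂ(g_j)·z^j‖ = ‖g_j‖·‖z‖^j`. [folklore] -/
theorem norm_term_eq (G : IwasawaAlgebra p) (z : ℂ_[p]) (j : ℕ) :
    ‖((algebraMap ℚ_[p] ℂ_[p]).comp (algebraMap ℤ_[p] ℚ_[p])) (PowerSeries.coeff j G) * z ^ j‖ =
      ‖PowerSeries.coeff j G‖ * ‖z‖ ^ j := by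
  rw [norm_mul, norm_pow, norm_algebraMap_comp_apply]

/-- `μ(G) = 0`, `λ(G) = n` ⇒ every coefficient below `n` has norm `≤ 1/p`. [cite: Washington1997, §7.1] -/
theorem norm_coeff_le_inv_of_lt_lam {G : IwasawaAlgebra p} (hG0 : G ≠ 0) (hμ : mu G = 0) {n : ℕ}
    (hlam : lam G = n) {j : ℕ} (hj : j < n) : ‖PowerSeries.coeff j G‖ ≤ (p : ℝ)⁻¹ := by
  have hunit : HasUnitContent G := hasUnitContent_of_mu_eq_zero hG0 hμ
  have hex : ∃ m, ‖PowerSeries.coeff m G‖ = 1 := (hasUnitContent_iff_exists_norm_eq_one G).mp hunit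
  have hnl : normLam G = n := by rw [← lam_eq_normLam hunit]; exact hlam
  have h1 : ‖PowerSeries.coeff (normLam G) G‖ = 1 := norm_coeff_normLam_eq_one hex
  have hlt := norm_coeff_lt_of_lt_normLam (F := G) (m := j) (by rw [hnl]; exact hj)
  rw [h1] at hlt
  exact Literature.NumberTheory.LFunctions.Dwork.PadicInt.norm_le_inv_of_norm_lt_one hlt

/-- The «other» terms: if `‖g_j‖ ≤ p⁻²` for `j < j₁` then every term `j ≠ j₁` of the evaluation
series has norm `≤ max(p⁻², p⁻¹‖z‖^{j₁+1}, ‖z‖ⁿ)`. [folklore] -/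
theorem norm_term_le_of_ne {G : IwasawaAlgebra p} (hG0 : G ≠ 0) (hμ : mu G = 0) {n : ℕ}
    (hlam : lam G = n) {z : ℂ_[p]} (hz : ‖z‖ < 1) {j₁ : ℕ}
    (hbelow : ∀ j < j₁, ‖PowerSeries.coeff j G‖ ≤ (p : ℝ)⁻¹ ^ 2) {j : ℕ} (hj : j ≠ j₁) :
    ‖((algebraMap ℚ_[p] ℂ_[p]).comp (algebraMap ℤ_[p] ℚ_[p])) (PowerSeries.coeff j G) * z ^ j‖ ≤
      max ((p : ℝ)⁻¹ ^ 2) (max ((p : ℝ)⁻¹ * ‖z‖ ^ (j₁ + 1)) (‖z‖ ^ n)) := by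
  have hr0 : 0 ≤ ‖z‖ := norm_nonneg _
  rw [norm_term_eq]
  rcases lt_trichotomy j j₁ with hlt | heq | hgt
  · refine le_trans ?_ (le_max_left _ _)
    calc ‖PowerSeries.coeff j G‖ * ‖z‖ ^ j ≤ (p : ℝ)⁻¹ ^ 2 * 1 :=
          mul_le_mul (hbelow j hlt) (pow_le_one₀ hr0 hz.le) (pow_nonneg hr0 _)
            (pow_nonneg (inv_nonneg.mpr (Nat.cast_nonneg _)) _)
      _ = (p : ℝ)⁻¹ ^ 2 := mul_one _
  · exact absurd heq hj
  · by_cases hjn : j < n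
    · refine le_trans ?_ (le_trans (le_max_left _ _) (le_max_right _ _))
      exact mul_le_mul (norm_coeff_le_inv_of_lt_lam hG0 hμ hlam hjn)
        (pow_le_pow_of_le_one hr0 hz.le (by omega)) (pow_nonneg hr0 _)
        (inv_nonneg.mpr (Nat.cast_nonneg _))
    · rw [not_lt] at hjn
      refine le_trans ?_ (le_trans (le_max_right _ _) (le_max_right _ _))
      calc ‖PowerSeries.coeff j G‖ * ‖z‖ ^ j ≤ 1 * ‖z‖ ^ n :=
          mul_le_mul (PadicInt.norm_le_one _) (pow_le_pow_of_le_one hr0 hz.le hjn)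
            (pow_nonneg hr0 _) zero_le_one
      _ = ‖z‖ ^ n := one_mul _

/-- **THE ISOLATION LEMMA (secondary reading).** `G ∈ Λ`, `μ(G) = 0`, `λ(G) = n`; `0 < ‖z‖ < 1`;
`k < n`, `p⁻¹ < ‖z‖^k`, `‖z‖ⁿ < p⁻¹‖z‖^k`. If `‖G(z)‖ = p⁻¹‖z‖^k` then **`‖[T^k]G‖ = 1/p`** and
`‖[T^j]G‖ ≤ p⁻²` for `j < k` (were an earlier coefficient of norm `1/p`, the least such term would
dominate strictly and give a larger value; then only the term `k` can reach `p⁻¹‖z‖^k`).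
[cite: Washington1997, §7.1–7.2] -/
theorem norm_coeff_eq_of_norm_tsum_eq_secondary {G : IwasawaAlgebra p} (hG0 : G ≠ 0)
    (hμ : mu G = 0) {n : ℕ} (hlam : lam G = n) {z : ℂ_[p]} (hz0 : 0 < ‖z‖) (hz : ‖z‖ < 1)
    {k : ℕ} (hkn : k < n) (H2 : (p : ℝ)⁻¹ < ‖z‖ ^ k) (H1 : ‖z‖ ^ n < (p : ℝ)⁻¹ * ‖z‖ ^ k)
    (h : ‖∑' j, ((algebraMap ℚ_[p] ℂ_[p]).comp (algebraMap ℤ_[p] ℚ_[p])) (PowerSeries.coeff j G) *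
      z ^ j‖ = (p : ℝ)⁻¹ * ‖z‖ ^ k) :
    ‖PowerSeries.coeff k G‖ = (p : ℝ)⁻¹ ∧ ∀ j < k, ‖PowerSeries.coeff j G‖ ≤ (p : ℝ)⁻¹ ^ 2 := by
  set ιZ : ℤ_[p] →+* ℂ_[p] := (algebraMap ℚ_[p] ℂ_[p]).comp (algebraMap ℤ_[p] ℚ_[p]) with hιZ
  set t : ℕ → ℂ_[p] := fun j ↦ ιZ (PowerSeries.coeff j G) * z ^ j with ht
  obtain ⟨hq0, hq1⟩ := inv_prime_pos_and_lt_one (p := p)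
  have hr0 : 0 ≤ ‖z‖ := norm_nonneg _
  have hsum : Summable t := summable_map_coeff_mul_pow ιZ (norm_algebraMap_coeff_le_one G) hz
  -- the bound B(j₁) on the other terms is STRICTLY below q·r^{j₁} whenever j₁ ≤ k
  have hB : ∀ j₁ ≤ k, max ((p : ℝ)⁻¹ ^ 2) (max ((p : ℝ)⁻¹ * ‖z‖ ^ (j₁ + 1)) (‖z‖ ^ n)) <
      (p : ℝ)⁻¹ * ‖z‖ ^ j₁ := by
    intro j₁ hj₁
    have hzk : ‖z‖ ^ k ≤ ‖z‖ ^ j₁ := pow_le_pow_of_le_one hr0 hz.le hj₁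
    have hqz : (p : ℝ)⁻¹ < ‖z‖ ^ j₁ := lt_of_lt_of_le H2 hzk
    refine max_lt ?_ (max_lt ?_ ?_)
    · calc (p : ℝ)⁻¹ ^ 2 = (p : ℝ)⁻¹ * (p : ℝ)⁻¹ := sq _
        _ < (p : ℝ)⁻¹ * ‖z‖ ^ j₁ := mul_lt_mul_of_pos_left hqz hq0
    · rw [pow_succ]
      calc (p : ℝ)⁻¹ * (‖z‖ ^ j₁ * ‖z‖) < (p : ℝ)⁻¹ * (‖z‖ ^ j₁ * 1) :=
            mul_lt_mul_of_pos_left (mul_lt_mul_of_pos_left hz (pow_pos hz0 _)) hq0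
        _ = (p : ℝ)⁻¹ * ‖z‖ ^ j₁ := by rw [mul_one]
    · exact lt_of_lt_of_le H1 (mul_le_mul_of_nonneg_left hzk hq0.le)
  -- splitting off one term and bounding the rest
  have hsplit : ∀ j₁, ∑' j, t j = t j₁ + ∑' j, ite (j = j₁) 0 (t j) :=
    fun j₁ ↦ hsum.tsum_eq_add_tsum_ite j₁
  have hrest : ∀ j₁, (∀ j < j₁, ‖PowerSeries.coeff j G‖ ≤ (p : ℝ)⁻¹ ^ 2) →
      ‖∑' j, ite (j = j₁) 0 (t j)‖ ≤
        max ((p : ℝ)⁻¹ ^ 2) (max ((p : ℝ)⁻¹ * ‖z‖ ^ (j₁ + 1)) (‖z‖ ^ n)) := by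
    intro j₁ hbelow
    refine IsUltrametricDist.norm_tsum_le_of_forall_le_of_nonneg
      (le_trans (sq_nonneg _) (le_max_left _ _)) fun j ↦ ?_
    by_cases hj : j = j₁
    · rw [if_pos hj, norm_zero]
      exact le_trans (pow_nonneg hq0.le 2) (le_max_left _ _)
    · rw [if_neg hj]
      exact norm_term_le_of_ne hG0 hμ hlam hz hbelow hj
  -- STEP 1: all coefficients below k are ≤ q²
  have hstep1 : ∀ j < k, ‖PowerSeries.coeff j G‖ ≤ (p : ℝ)⁻¹ ^ 2 := by
    by_contra hcon
    -- least bad index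
    let P : ℕ → Prop := fun j ↦ j < k ∧ ¬ ‖PowerSeries.coeff j G‖ ≤ (p : ℝ)⁻¹ ^ 2
    have hP : ∃ j, P j := by
      obtain ⟨j, hj⟩ := not_forall.mp hcon
      exact ⟨j, Classical.not_imp.mp hj⟩
    let j₁ := Nat.find hP
    have hj₁ : P j₁ := Nat.find_spec hP
    have hmin : ∀ j < j₁, ¬ P j := fun j hj ↦ Nat.find_min hP hj
    have hj₁k : j₁ < k := hj₁.1
    have hbelow : ∀ j < j₁, ‖PowerSeries.coeff j G‖ ≤ (p : ℝ)⁻¹ ^ 2 := by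
      intro j hj
      by_contra hb
      exact hmin j hj ⟨lt_trans hj hj₁k, hb⟩
    have hnorm : ‖PowerSeries.coeff j₁ G‖ = (p : ℝ)⁻¹ :=
      norm_eq_inv_of_le_of_not_le (norm_coeff_le_inv_of_lt_lam hG0 hμ hlam (lt_trans hj₁k hkn))
        hj₁.2
    have ht₁ : ‖t j₁‖ = (p : ℝ)⁻¹ * ‖z‖ ^ j₁ := by rw [ht]; simp only; rw [norm_term_eq, hnorm]
    have hR := hrest j₁ hbelow
    have hRlt : ‖∑' j, ite (j = j₁) 0 (t j)‖ < ‖t j₁‖ := by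
      rw [ht₁]; exact lt_of_le_of_lt hR (hB j₁ hj₁k.le)
    have hval : ‖∑' j, t j‖ = (p : ℝ)⁻¹ * ‖z‖ ^ j₁ := by
      rw [hsplit j₁, norm_add_eq_left_of_lt hRlt, ht₁]
    have hval' : ‖∑' j, t j‖ = (p : ℝ)⁻¹ * ‖z‖ ^ k := h
    have hlt : (p : ℝ)⁻¹ * ‖z‖ ^ k < (p : ℝ)⁻¹ * ‖z‖ ^ j₁ :=
      mul_lt_mul_of_pos_left (pow_lt_pow_right_of_lt_one₀ hz0 hz hj₁k) hq0
    rw [← hval, hval'] at hlt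
    exact lt_irrefl _ hlt
  -- STEP 2: the coefficient k has norm exactly q
  refine ⟨?_, hstep1⟩
  apply norm_eq_inv_of_le_of_not_le (norm_coeff_le_inv_of_lt_lam hG0 hμ hlam hkn)
  intro hk2
  have hR := hrest k hstep1
  have htk : ‖t k‖ ≤ max ((p : ℝ)⁻¹ ^ 2) (max ((p : ℝ)⁻¹ * ‖z‖ ^ (k + 1)) (‖z‖ ^ n)) := by
    refine le_trans ?_ (le_max_left _ _)
    rw [ht]; simp only; rw [norm_term_eq]
    calc ‖PowerSeries.coeff k G‖ * ‖z‖ ^ k ≤ (p : ℝ)⁻¹ ^ 2 * 1 :=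
          mul_le_mul hk2 (pow_le_one₀ hr0 hz.le) (pow_nonneg hr0 _) (pow_nonneg hq0.le _)
      _ = (p : ℝ)⁻¹ ^ 2 := mul_one _
  have hall : ‖∑' j, t j‖ ≤ max ((p : ℝ)⁻¹ ^ 2) (max ((p : ℝ)⁻¹ * ‖z‖ ^ (k + 1)) (‖z‖ ^ n)) := by
    rw [hsplit k]
    exact le_trans (IsUltrametricDist.norm_add_le_max _ _) (max_le htk hR)
  have := lt_of_le_of_lt hall (hB k le_rfl)
  rw [h] at this
  exact lt_irrefl _ this

end Isolation

/-! ## §2. At a primitive `p^{m+1}`-th root of unity: the reading `V = φ(p^{m+1}) + k` -/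

section RootOfUnity
/-- **Secondary reading at `ζ − 1`** (`ζ` of order `p^{m+1}`, `φ := φ(p^{m+1})`, `k < φ`,
`φ + k < n = λ(G)`, `μ(G) = 0`): `‖G(ζ − 1)‖^φ = p^{−(φ + k)}` (the engine's UNDETERMINED value
`V = φ + k`) ⇒ `‖[T^k]G‖ = 1/p`, `[T^k]G ≠ 0`, `ord_{T=0} G ≤ k`, `‖[T^j]G‖ ≤ p⁻²` (`j < k`).
[cite: Washington1997, §7.1–7.2] -/
theorem norm_coeff_eq_of_norm_tsum_pow_eq_secondary {G : IwasawaAlgebra p} (hG0 : G ≠ 0)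
    (hμ : mu G = 0) {n : ℕ} (hlam : lam G = n) {m : ℕ} {ζ : ℂ_[p]}
    (hζ : IsPrimitiveRoot ζ (p ^ (m + 1))) {k : ℕ} (hk : k < Nat.totient (p ^ (m + 1)))
    (hkn : Nat.totient (p ^ (m + 1)) + k < n)
    (h : ‖∑' j, ((algebraMap ℚ_[p] ℂ_[p]).comp (algebraMap ℤ_[p] ℚ_[p])) (PowerSeries.coeff j G) *
      (ζ - 1) ^ j‖ ^ Nat.totient (p ^ (m + 1)) = ((p : ℝ)⁻¹) ^ (Nat.totient (p ^ (m + 1)) + k)) :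
    ‖PowerSeries.coeff k G‖ = (p : ℝ)⁻¹ ∧ PowerSeries.coeff k G ≠ 0 ∧ G.order ≤ k ∧
      ∀ j < k, ‖PowerSeries.coeff j G‖ ≤ (p : ℝ)⁻¹ ^ 2 := by
  obtain ⟨hq0, hq1⟩ := inv_prime_pos_and_lt_one (p := p)
  obtain ⟨hr0, hr1⟩ := norm_sub_one_pos_and_lt_one hζ
  have hφ := norm_sub_one_pow_totient_eq hζ   -- ‖ζ-1‖^φ = p⁻¹
  set φ := Nat.totient (p ^ (m + 1)) with hφdef
  have hφ0 : φ ≠ 0 := (Nat.totient_pos.mpr (pow_pos hp.out.pos _)).ne'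
  -- ‖G(ζ-1)‖ = q·r^k : both sides nonneg with equal φ-th powers
  have hval : ‖∑' j, ((algebraMap ℚ_[p] ℂ_[p]).comp (algebraMap ℤ_[p] ℚ_[p]))
      (PowerSeries.coeff j G) * (ζ - 1) ^ j‖ = (p : ℝ)⁻¹ * ‖ζ - 1‖ ^ k := by
    have hpow : ((p : ℝ)⁻¹ * ‖ζ - 1‖ ^ k) ^ φ = ((p : ℝ)⁻¹) ^ (φ + k) := by
      rw [mul_pow, ← pow_mul, mul_comm k φ, pow_mul, hφ, pow_add]
    rw [← hpow] at h
    exact (pow_left_inj₀ (norm_nonneg _) (mul_nonneg hq0.le (pow_nonneg hr0.le _)) hφ0).mp h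
  have H2 : (p : ℝ)⁻¹ < ‖ζ - 1‖ ^ k := by
    rw [← hφ]; exact pow_lt_pow_right_of_lt_one₀ hr0 hr1 hk
  have H1 : ‖ζ - 1‖ ^ n < (p : ℝ)⁻¹ * ‖ζ - 1‖ ^ k := by
    have hle : ‖ζ - 1‖ ^ n ≤ ‖ζ - 1‖ ^ (φ + k + 1) :=
      pow_le_pow_of_le_one hr0.le hr1.le (by omega)
    have heq : ‖ζ - 1‖ ^ (φ + k + 1) = (p : ℝ)⁻¹ * ‖ζ - 1‖ ^ k * ‖ζ - 1‖ := by
      rw [pow_succ, pow_add, hφ]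
    rw [heq] at hle
    calc ‖ζ - 1‖ ^ n ≤ (p : ℝ)⁻¹ * ‖ζ - 1‖ ^ k * ‖ζ - 1‖ := hle
      _ < (p : ℝ)⁻¹ * ‖ζ - 1‖ ^ k * 1 :=
          mul_lt_mul_of_pos_left hr1 (mul_pos hq0 (pow_pos hr0 _))
      _ = (p : ℝ)⁻¹ * ‖ζ - 1‖ ^ k := mul_one _
  obtain ⟨hnk, hbelow⟩ :=
    norm_coeff_eq_of_norm_tsum_eq_secondary hG0 hμ hlam hr0 hr1 (by omega) H2 H1 hval
  have hne : PowerSeries.coeff k G ≠ 0 := by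
    intro h0; rw [h0, norm_zero] at hnk; exact absurd hnk hq0.ne
  exact ⟨hnk, hne, PowerSeries.order_le k hne, hbelow⟩

end RootOfUnity

/-! ## §3. Twisted interpolation: TWO Birch sums give `ord_{T=0} L_p ≤ k` (and `= 1`) -/

section Twists
variable {N : ℕ} {f : CuspForm (Gamma0 N) 2}

/-- `ι(G) = ϖ·L` forces `‖[T^j]G‖ = ‖ϖ·[T^j]L‖`; in particular `[T^j]G ≠ 0 ⇒ [T^j]L ≠ 0`. [folklore] -/
theorem coeff_ne_zero_of_iota_eq {G : IwasawaAlgebra p} {ϖ : ℚ_[p]} {L : PowerSeries ℚ_[p]}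
    (hG : iwasawaToPowerSeries p G = PowerSeries.C ϖ * L) {j : ℕ}
    (hj : PowerSeries.coeff j G ≠ 0) : PowerSeries.coeff j L ≠ 0 := by
  intro h0
  have hn := EisensteinPrimesX2AnalyticLambdaCertificate.norm_coeff_eq_of_iota_eq hG j
  rw [PowerSeries.coeff_C_mul, h0, mul_zero, norm_zero, norm_eq_zero] at hn
  exact hj hn

/-- **TWO BIRCH SUMS give the order of vanishing** (`L` with the Mazur–Tate–Teitelbaum twisted
clause `hI` for `(f, α)`, integral model `ι(G) = ϖ·L ≠ 0`): `χ₁` of conductor `p^{n+1+e₀}` with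
`|ϖα^{−·}Birch(χ₁)|^{φ(pⁿ⁺¹)} = p^{−V}`, `V < φ(pⁿ⁺¹)` (`μ = 0`, `λ = V`), and `χ₂` of conductor
`p^{m+1+e₀}` with `|ϖα^{−·}Birch(χ₂)|^{φ(p^{m+1})} = p^{−(φ(p^{m+1})+k)}`, `k < φ(p^{m+1})`,
`φ(p^{m+1}) + k < V` ⇒ `‖[T^k]G‖ = 1/p`, `[T^k]L ≠ 0`, `ord_{T=0} L ≤ k`.
[cite: MazurTateTeitelbaum1986Invent, §I.13–I.14] [cite: Washington1997, §7.1–7.2] -/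
theorem order_le_of_two_twists {α : ℚ_[p]} {L : PowerSeries ℚ_[p]}
    (hI : ∀ (m : ℕ), 0 < m → ∀ χ : DirichletCharacter ℂ_[p] (p ^ m), χ.IsPrimitive → χ.Even →
      (∃ j : ℕ, orderOf χ = p ^ j) →
        HasSum (fun k : ℕ ↦ algebraMap ℚ_[p] ℂ_[p] (PowerSeries.coeff k L) *
            (χ (cyclotomicGenerator p : ZMod (p ^ m)) - 1) ^ k)
          (algebraMap ℚ_[p] ℂ_[p] (α⁻¹ ^ m) * ratTwistedSymbolSum f χ))
    {G : IwasawaAlgebra p} {ϖ : ℚ_[p]} (hG : iwasawaToPowerSeries p G = PowerSeries.C ϖ * L)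
    (hG0 : G ≠ 0)
    {n : ℕ} (χ₁ : DirichletCharacter ℂ_[p] (p ^ (n + 1 + cyclotomicExponent p)))
    (hχ₁ : χ₁.IsPrimitive) (heven₁ : χ₁.Even) (hord₁ : ∃ j : ℕ, orderOf χ₁ = p ^ j) {V : ℕ}
    (hV : V < Nat.totient (p ^ (n + 1)))
    (h₁ : ‖algebraMap ℚ_[p] ℂ_[p] ϖ * (algebraMap ℚ_[p] ℂ_[p] (α⁻¹ ^ (n + 1 + cyclotomicExponent p)) *
      ratTwistedSymbolSum f χ₁)‖ ^ Nat.totient (p ^ (n + 1)) = ((p : ℝ)⁻¹) ^ V)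
    {m : ℕ} (χ₂ : DirichletCharacter ℂ_[p] (p ^ (m + 1 + cyclotomicExponent p)))
    (hχ₂ : χ₂.IsPrimitive) (heven₂ : χ₂.Even) (hord₂ : ∃ j : ℕ, orderOf χ₂ = p ^ j) {k : ℕ}
    (hk : k < Nat.totient (p ^ (m + 1))) (hkV : Nat.totient (p ^ (m + 1)) + k < V)
    (h₂ : ‖algebraMap ℚ_[p] ℂ_[p] ϖ * (algebraMap ℚ_[p] ℂ_[p] (α⁻¹ ^ (m + 1 + cyclotomicExponent p)) *
      ratTwistedSymbolSum f χ₂)‖ ^ Nat.totient (p ^ (m + 1)) =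
        ((p : ℝ)⁻¹) ^ (Nat.totient (p ^ (m + 1)) + k)) :
    ‖PowerSeries.coeff k G‖ = (p : ℝ)⁻¹ ∧ PowerSeries.coeff k L ≠ 0 ∧ L.order ≤ k := by
  obtain ⟨hμ, hlam⟩ := mu_eq_zero_and_lam_eq_of_norm_twist_pow_eq hI hG hG0 χ₁ hχ₁ heven₁ hord₁ hV h₁
  have hm : 0 < m + 1 + cyclotomicExponent p := by omega
  rw [← (hasSum_integralModel_eq_ratTwistedSymbolSum hI hG hm χ₂ hχ₂ heven₂ hord₂).tsum_eq] at h₂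
  obtain ⟨hnk, hne, -, -⟩ := norm_coeff_eq_of_norm_tsum_pow_eq_secondary hG0 hμ hlam
    (isPrimitiveRoot_apply_cyclotomicGenerator χ₂ hχ₂ heven₂ hord₂) hk hkV h₂
  have hneL := coeff_ne_zero_of_iota_eq hG hne
  exact ⟨hnk, hneL, PowerSeries.order_le k hneL⟩

/-- **`ord_{T=0} L = 1` from two Birch sums and `L(0) = 0`.** With `k = 1` in
`order_le_of_two_twists` and a vanishing constant term (analytic rank `≥ 1`: `L(E,1) = 0`, or the
exceptional zero), `ord_{T=0} L = 1` — the order-of-vanishing input of the `p`-adic certificate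
engine, from twisted values only. [cite: MazurTateTeitelbaum1986Invent, §I.13–I.14] [cite: Schneider1985, Thm. 1] -/
theorem order_eq_one_of_two_twists {α : ℚ_[p]} {L : PowerSeries ℚ_[p]}
    (hI : ∀ (m : ℕ), 0 < m → ∀ χ : DirichletCharacter ℂ_[p] (p ^ m), χ.IsPrimitive → χ.Even →
      (∃ j : ℕ, orderOf χ = p ^ j) →
        HasSum (fun k : ℕ ↦ algebraMap ℚ_[p] ℂ_[p] (PowerSeries.coeff k L) *
            (χ (cyclotomicGenerator p : ZMod (p ^ m)) - 1) ^ k)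
          (algebraMap ℚ_[p] ℂ_[p] (α⁻¹ ^ m) * ratTwistedSymbolSum f χ))
    {G : IwasawaAlgebra p} {ϖ : ℚ_[p]} (hG : iwasawaToPowerSeries p G = PowerSeries.C ϖ * L)
    (hG0 : G ≠ 0) (hL0 : PowerSeries.constantCoeff L = 0)
    {n : ℕ} (χ₁ : DirichletCharacter ℂ_[p] (p ^ (n + 1 + cyclotomicExponent p)))
    (hχ₁ : χ₁.IsPrimitive) (heven₁ : χ₁.Even) (hord₁ : ∃ j : ℕ, orderOf χ₁ = p ^ j) {V : ℕ}
    (hV : V < Nat.totient (p ^ (n + 1)))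
    (h₁ : ‖algebraMap ℚ_[p] ℂ_[p] ϖ * (algebraMap ℚ_[p] ℂ_[p] (α⁻¹ ^ (n + 1 + cyclotomicExponent p)) *
      ratTwistedSymbolSum f χ₁)‖ ^ Nat.totient (p ^ (n + 1)) = ((p : ℝ)⁻¹) ^ V)
    {m : ℕ} (χ₂ : DirichletCharacter ℂ_[p] (p ^ (m + 1 + cyclotomicExponent p)))
    (hχ₂ : χ₂.IsPrimitive) (heven₂ : χ₂.Even) (hord₂ : ∃ j : ℕ, orderOf χ₂ = p ^ j)
    (hk : 1 < Nat.totient (p ^ (m + 1))) (hkV : Nat.totient (p ^ (m + 1)) + 1 < V)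
    (h₂ : ‖algebraMap ℚ_[p] ℂ_[p] ϖ * (algebraMap ℚ_[p] ℂ_[p] (α⁻¹ ^ (m + 1 + cyclotomicExponent p)) *
      ratTwistedSymbolSum f χ₂)‖ ^ Nat.totient (p ^ (m + 1)) =
        ((p : ℝ)⁻¹) ^ (Nat.totient (p ^ (m + 1)) + 1)) :
    L.order = 1 := by
  obtain ⟨-, hne, hle⟩ := order_le_of_two_twists hI hG hG0 χ₁ hχ₁ heven₁ hord₁ hV h₁ χ₂ hχ₂ heven₂
    hord₂ hk hkV h₂
  refine le_antisymm hle ?_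
  -- order ≥ 1 since the constant term vanishes
  have h1 : ((1 : ℕ) : ℕ∞) ≤ L.order := by
    refine PowerSeries.nat_le_order L 1 fun i hi ↦ ?_
    have hi0 : i = 0 := by omega
    subst hi0
    rw [PowerSeries.coeff_zero_eq_constantCoeff]; exact hL0
  simpa using h1

end Twists

/-! ## §3b. Good ordinary `p`: `α = unitRoot`, the statements are about `|ϖ·Birch(χ)|` -/

section Ordinary
variable {N : ℕ} [NeZero N] {f : CuspForm (Gamma0 N) 2} {W : WeierstrassCurve ℚ} [W.IsElliptic]
  [W.IsGloballyMinimal]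

/-- **Good ordinary `p` (class X1): two Birch sums of the Néron-normalised `L_p(E,T)` give
`‖[T^k]G‖ = 1/p` and `ord_{T=0} L_p ≤ k`** (JOB «engM-deep8» @3: `n + 1 = 5`, `λ ∈ {81, 83, 85}`;
`m + 1 = 4`, `φ = 54`, `V = 55` ⇒ `[T¹](ϖ·L₃(E)) ≠ 0`, `‖[T¹]G‖ = 1/3`).
[cite: MazurSwinnertonDyer1974Invent, §9] [cite: MazurTateTeitelbaum1986Invent, §I.14 (14.3)] -/
theorem ordinary_order_le_of_two_twists (hord : IsOrdinaryAt W p) (hf : IsNewformOf W f)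
    {G : IwasawaAlgebra p} {ϖ : ℚ_[p]}
    (hG : iwasawaToPowerSeries p G = PowerSeries.C ϖ * padicLFunction f (unitRoot W p : ℚ_[p]))
    (hG0 : G ≠ 0) {n : ℕ} (χ₁ : DirichletCharacter ℂ_[p] (p ^ (n + 1 + cyclotomicExponent p)))
    (hχ₁ : χ₁.IsPrimitive) (heven₁ : χ₁.Even) (hord₁ : ∃ j : ℕ, orderOf χ₁ = p ^ j) {V : ℕ}
    (hV : V < Nat.totient (p ^ (n + 1)))
    (h₁ : ‖algebraMap ℚ_[p] ℂ_[p] ϖ * ratTwistedSymbolSum f χ₁‖ ^ Nat.totient (p ^ (n + 1)) =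
      ((p : ℝ)⁻¹) ^ V)
    {m : ℕ} (χ₂ : DirichletCharacter ℂ_[p] (p ^ (m + 1 + cyclotomicExponent p)))
    (hχ₂ : χ₂.IsPrimitive) (heven₂ : χ₂.Even) (hord₂ : ∃ j : ℕ, orderOf χ₂ = p ^ j) {k : ℕ}
    (hk : k < Nat.totient (p ^ (m + 1))) (hkV : Nat.totient (p ^ (m + 1)) + k < V)
    (h₂ : ‖algebraMap ℚ_[p] ℂ_[p] ϖ * ratTwistedSymbolSum f χ₂‖ ^ Nat.totient (p ^ (m + 1)) =
      ((p : ℝ)⁻¹) ^ (Nat.totient (p ^ (m + 1)) + k)) :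
    ‖PowerSeries.coeff k G‖ = (p : ℝ)⁻¹ ∧
      PowerSeries.coeff k (padicLFunction f (unitRoot W p : ℚ_[p])) ≠ 0 ∧
      (padicLFunction f (unitRoot W p : ℚ_[p])).order ≤ k := by
  have hI := (isPAdicLFunctionOf_padicLFunction_holds hord hf).2
  have e : ∀ (j : ℕ) (χ : DirichletCharacter ℂ_[p] (p ^ j)),
      ‖algebraMap ℚ_[p] ℂ_[p] ϖ * (algebraMap ℚ_[p] ℂ_[p] ((unitRoot W p : ℚ_[p])⁻¹ ^ j) *
        ratTwistedSymbolSum f χ)‖ = ‖algebraMap ℚ_[p] ℂ_[p] ϖ * ratTwistedSymbolSum f χ‖ := by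
    intro j χ
    rw [norm_mul, norm_mul, norm_algebraMap_unitRoot_inv_pow hord, one_mul, ← norm_mul]
  have h₁' := h₁; rw [← e] at h₁'
  have h₂' := h₂; rw [← e] at h₂'
  exact order_le_of_two_twists hI hG hG0 χ₁ hχ₁ heven₁ hord₁ hV h₁' χ₂ hχ₂ heven₂ hord₂ hk hkV h₂'

end Ordinary

end Summit.BirchSwinnertonDyer.BirchSwinnertonDyer.Theorems.EisensteinPrimesSecondaryBirchReading

end
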